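import Mathlib.Analysis.SpecificLimits.Normed
import Mathlib.Analysis.SpecialFunctions.Pow.NNReal
import Literature.Barriers.MatrixMultiplication.UniversalMethodBarrierMatMul
import Literature.Barriers.MatrixMultiplication.UniversalMethodBarrierDegenerationPow
import Literature.Computability.AlgebraicComplexity.AsymptoticSumInequality
import HarnessLib

/-!
# Alman 2021, Theorem 2.9 — proved (`Alman2021_thm29_holds`)

Topic `Literature/Barriers/MatrixMultiplication`; DISCHARGE of the named fact `Alman2021_thm29` of
the catalogue entry `UniversalMethodBarrier` (`UniversalMethodBarrier.lean`): for a variable-symmetric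
tensor `T` over any field with `S̃(T) > 1` and `ω_u(T)` defined,
`ω_u(T) ≥ 2 log R̃(T) / log S̃(T)`. Sorry-free; all ingredients are proved in the sibling files
`UniversalMethodBarrier{SliceRank,Degeneration,DegenerationPow,DegenerationSliceRank,Products,MatMul}.lean`.

## Proof (Alman 2021, p. 13–14, made effective)

Let `w ∈ [2,3]` qualify, i.e. `R̃(T) ≤ V_{w/3}(T)`, and suppose `ρ := S̃(T)^{w/2} < R̃(T)`. Pick `v`
in the set defining `V_{w/3}` with `ρ < v`: `T^{⊗n} ⊵ ⊕ᵢ ⟨aᵢ,bᵢ,cᵢ⟩` with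
`Σᵢ (aᵢbᵢcᵢ)^{w/3} = vⁿ > ρⁿ`. For every `N`, one type class of `(⊕ᵢ …)^{⊗N}` gives
`T^{⊗Nn} ⊵ F ⊙ ⟨A,B,C⟩` with `v^{nN} ≤ (N+1)^p F (ABC)^{w/3}` (`exists_typeClass`, after Bläser's
proof of the asymptotic sum inequality); by symmetry also `⊵ F ⊙ ⟨B,C,A⟩`, `F ⊙ ⟨C,A,B⟩`, hence
`T^{⊗3Nn} ⊵ F³ ⊙ ⟨ABC,ABC,ABC⟩`, so `F³(ABC)² ≤ 2 S(T^{⊗3Nn}) ≤ 2 S̃(T)^{3Nn}` (Strassen's diagonal,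
Tao's lemma, Prop. 2.3). With `F ≥ 1` and `w ≥ 2` this yields `v^{nN} ≤ 2 (N+1)^p ρ^{nN}`
(`sum_rpow_pow_le_asymptoticSliceRank`) — the step where print uses `R̃ ≥ S̃` is replaced by
`F^{1-w/2} ≤ 1` — contradicting `v > ρ` as `N → ∞`. Hence `2 log R̃ / log S̃ ≤ w` for every qualifying
`w` (`two_mul_log_div_log_le_of_qualifying`), and `ω_u(T)`, the infimum of the qualifying `w`
(with `3` adjoined), is at least `2 log R̃ / log S̃`.

## Content

* `tensorRestrictsTo_kroneckerPow_matMulDirectSum_multiple` (block extraction as a restriction),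
  `exists_typeClass`, `sum_rpow_pow_le_asymptoticSliceRank`, `zero_mem_degenerationValue_set`,
  `two_mul_log_div_log_le_of_qualifying`, `Alman2021_thm29_holds`.

## References

* J. Alman, *Limits on the Universal Method for Matrix Multiplication*, Theory of Computing 17
  (2021), Thm. 2.9 and its proof, §2.5 (held: `doi-10-4086-toc-2021-v017a001`, pp. 11–14). [Alman2021]
* M. Bläser, *Fast Matrix Multiplication* (2013), proof of Thm. 7.5 (type classes). [Blaser2013]
-/

noncomputable section

open scoped BigOperators

namespace Literature.Barriers.MatrixMultiplication

open Literature.Computability.AlgebraicComplexity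
open Filter Topology

universe u

/-! ## One type class of `(⊕ᵢ ⟨kᵢ,mᵢ,nᵢ⟩)^{⊗N}` -/

section TypeClass

variable (K : Type u) [CommSemiring K] {p : ℕ} (k m n : Fin p → ℕ)

/-- **Block extraction as a restriction** (Bläser 2013, proof of Thm. 7.5; the tree's
`tensorRank_multiple_le_kroneckerPow_matMulDirectSum` in restriction form): for an injective family
`rep` of words all of whose blocks have format `⟨K',M',N'⟩`,
`(⊕ᵢ ⟨kᵢ,mᵢ,nᵢ⟩)^{⊗N} ≥ F ⊙ ⟨K',M',N'⟩`. [cite: Blaser2013, Thm. 7.5 (proof)] -/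
theorem tensorRestrictsTo_kroneckerPow_matMulDirectSum_multiple {N F K' M' N' : ℕ}
    (rep : Fin F → (Fin N → Fin p)) (hrep : Function.Injective rep)
    (hK : ∀ β, ∏ j, k (rep β j) = K') (hM : ∀ β, ∏ j, m (rep β j) = M')
    (hN : ∀ β, ∏ j, n (rep β j) = N') :
    TensorRestrictsTo (kroneckerPow (matMulDirectSum K k m n) N)
      (kroneckerTensor (unitTensor K F) (matMulTensor K K' M' N')) := by
  classical
  obtain ⟨eK, -⟩ : ∃ _e : ∀ β, Fin K' ≃ (∀ j : Fin N, Fin (k (rep β j))), True :=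
    ⟨fun β => (Fintype.equivFinOfCardEq ((Fintype.card_pi (α := fun j => Fin (k (rep β j)))).trans
      (by simp only [Fintype.card_fin]; exact hK β))).symm, trivial⟩
  obtain ⟨eM, -⟩ : ∃ _e : ∀ β, Fin M' ≃ (∀ j : Fin N, Fin (m (rep β j))), True :=
    ⟨fun β => (Fintype.equivFinOfCardEq ((Fintype.card_pi (α := fun j => Fin (m (rep β j)))).trans
      (by simp only [Fintype.card_fin]; exact hM β))).symm, trivial⟩
  obtain ⟨eN, -⟩ : ∃ _e : ∀ β, Fin N' ≃ (∀ j : Fin N, Fin (n (rep β j))), True :=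
    ⟨fun β => (Fintype.equivFinOfCardEq ((Fintype.card_pi (α := fun j => Fin (n (rep β j)))).trans
      (by simp only [Fintype.card_fin]; exact hN β))).symm, trivial⟩
  have key : kroneckerTensor (unitTensor K F) (matMulTensor K K' M' N') = fun a b c =>
      kroneckerPow (matMulDirectSum K k m n) N
        (fun j => ⟨rep a.1 j, (eK a.1 a.2.1 j, eN a.1 a.2.2 j)⟩)
        (fun j => ⟨rep b.1 j, (eK b.1 b.2.1 j, eM b.1 b.2.2 j)⟩)
        (fun j => ⟨rep c.1 j, (eM c.1 c.2.1 j, eN c.1 c.2.2 j)⟩) := by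
    funext a b c
    obtain ⟨β₁, κ, ν⟩ := a
    obtain ⟨β₂, κ', μ'⟩ := b
    obtain ⟨β₃, μ'', ν''⟩ := c
    simp only [kroneckerTensor_unitTensor_apply, matMulTensor, kroneckerPow_apply, matMulDirectSum]
    rw [Fintype.prod_boole, ← ite_and]
    refine ite_congr_prop ?_
    constructor
    · rintro ⟨⟨rfl, rfl⟩, rfl, rfl, rfl⟩ j
      simp
    · intro H
      have h12 : β₁ = β₂ := by
        by_contra hne
        obtain ⟨j, hj⟩ := Function.ne_iff.1 (fun h => hne (hrep h) : rep β₁ ≠ rep β₂)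
        exact hj (H j).1
      subst h12
      have h13 : β₁ = β₃ := by
        by_contra hne
        obtain ⟨j, hj⟩ := Function.ne_iff.1 (fun h => hne (hrep h) : rep β₁ ≠ rep β₃)
        exact hj (H j).2.1
      subst h13
      refine ⟨⟨rfl, rfl⟩, ?_, ?_, ?_⟩
      · exact (eK β₁).injective (funext fun j => Fin.ext (H j).2.2.1)
      · exact (eM β₁).injective (funext fun j => Fin.ext (H j).2.2.2.1)
      · exact (eN β₁).injective (funext fun j => Fin.ext (H j).2.2.2.2)
  rw [key]
  exact tensorRestrictsTo_precomp _ _ _ _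

end TypeClass

section ClassChoice

variable (K : Type u) [Field K] {p : ℕ} (k m n : Fin p → ℕ)

/-- **The best type class** (Alman 2021, proof of Thm. 2.9, "by definition of `ω_u` … `T^{⊗n}` has a
degeneration to `F ⊙ ⟨a,b,c⟩`"; Bläser 2013, proof of Thm. 7.5): for every real `τ` and every `N`,
some type class of words gives `F ⊙ ⟨K',M',N'⟩ ≤ (⊕ᵢ ⟨kᵢ,mᵢ,nᵢ⟩)^{⊗N}` with
`(Σᵢ (kᵢmᵢnᵢ)^τ)^N ≤ (N+1)^p · F · (K'M'N')^τ` (at most `(N+1)^p` classes), the block format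
being a product of block formats. [cite: Alman2021, Thm. 2.9 (proof)] -/
theorem exists_typeClass (τ : ℝ) (N : ℕ) (hpos : ∀ i, 0 < k i ∧ 0 < m i ∧ 0 < n i) :
    ∃ F K' M' N' : ℕ, 0 < K' ∧ 0 < M' ∧ 0 < N' ∧
      TensorRestrictsTo (kroneckerPow (matMulDirectSum K k m n) N)
        (kroneckerTensor (unitTensor K F) (matMulTensor K K' M' N')) ∧
      (∑ i, ((k i * m i * n i : ℕ) : ℝ) ^ τ) ^ N ≤
        ((N : ℝ) + 1) ^ p * ((F : ℝ) * ((K' * M' * N' : ℕ) : ℝ) ^ τ) := by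
  classical
  -- the value of a word
  set X : (Fin N → Fin p) → ℝ := fun w =>
    (((∏ j, k (w j)) * (∏ j, m (w j)) * (∏ j, n (w j)) : ℕ) : ℝ) ^ τ with hX
  have hX0 : ∀ w, 0 ≤ X w := fun w => by positivity
  have hexpand : (∑ i, ((k i * m i * n i : ℕ) : ℝ) ^ τ) ^ N = ∑ w : Fin N → Fin p, X w := by
    rw [Fintype.sum_pow]
    refine Finset.sum_congr rfl fun w _ => ?_
    rw [hX]
    dsimp only
    rw [Real.finsetProd_rpow _ _ (fun i _ => by positivity)]
    congr 1
    push_cast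
    rw [Finset.prod_mul_distrib, Finset.prod_mul_distrib]
  -- the type of a word
  obtain ⟨wt, hwt⟩ : ∃ wt : (Fin N → Fin p) → (Fin p → Fin (N + 1)),
      ∀ w i, ((wt w i : Fin (N + 1)) : ℕ) = (Finset.univ.filter fun j => w j = i).card :=
    ⟨fun w i => ⟨(Finset.univ.filter fun j => w j = i).card,
      Nat.lt_succ_of_le ((Finset.card_filter_le _ _).trans (by simp))⟩, fun w i => rfl⟩
  -- the best class
  set G : (Fin p → Fin (N + 1)) → ℝ := fun c => ∑ w ∈ Finset.univ.filter (fun w => wt w = c), X w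
    with hG
  obtain ⟨c₀, -, hc₀⟩ := Finset.exists_max_image Finset.univ G Finset.univ_nonempty
  have hbound : (∑ i, ((k i * m i * n i : ℕ) : ℝ) ^ τ) ^ N ≤ ((N : ℝ) + 1) ^ p * G c₀ := by
    rw [hexpand, ← Finset.sum_fiberwise Finset.univ wt X]
    calc ∑ c : Fin p → Fin (N + 1), ∑ w ∈ Finset.univ.filter (fun w => wt w = c), X w
        ≤ ∑ _c : Fin p → Fin (N + 1), G c₀ := Finset.sum_le_sum fun c _ => hc₀ c (Finset.mem_univ _)
      _ = ((N : ℝ) + 1) ^ p * G c₀ := by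
        rw [Finset.sum_const, Finset.card_univ, Fintype.card_fun, Fintype.card_fin, Fintype.card_fin,
          nsmul_eq_mul]
        push_cast
        ring
  set S := Finset.univ.filter (fun w : Fin N → Fin p => wt w = c₀) with hS
  rcases S.eq_empty_or_nonempty with hemp | ⟨w₀, hw₀⟩
  · -- empty class: everything is `0`
    refine ⟨0, 1, 1, 1, Nat.one_pos, Nat.one_pos, Nat.one_pos, ?_, ?_⟩
    · exact ⟨fun a => Fin.elim0 a.1, fun b => Fin.elim0 b.1, fun c => Fin.elim0 c.1,
        fun a => Fin.elim0 a.1⟩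
    · have : G c₀ = 0 := by rw [hG]; dsimp only; rw [← hS, hemp, Finset.sum_empty]
      rw [this, mul_zero] at hbound
      simpa using hbound
  -- non-empty class with representative `w₀`
  have hmem : ∀ w ∈ S, ∀ i, (Finset.univ.filter fun j => w j = i).card =
      (Finset.univ.filter fun j => w₀ j = i).card := fun w hw i => by
    rw [← hwt, ← hwt, (Finset.mem_filter.1 hw).2, (Finset.mem_filter.1 hw₀).2]
  have hconst : ∀ w ∈ S, X w = X w₀ := fun w hw => by
    simp only [hX]
    rw [prod_eq_of_card_filter_eq (hmem w hw) k, prod_eq_of_card_filter_eq (hmem w hw) m,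
      prod_eq_of_card_filter_eq (hmem w hw) n]
  set rep : Fin S.card → (Fin N → Fin p) := fun β => (S.equivFin.symm β).1 with hrep
  have hrep_mem : ∀ β, rep β ∈ S := fun β => (S.equivFin.symm β).2
  have hinj : Function.Injective rep := fun β β' hβ =>
    S.equivFin.symm.injective (Subtype.ext hβ)
  refine ⟨S.card, ∏ j, k (w₀ j), ∏ j, m (w₀ j), ∏ j, n (w₀ j),
    Finset.prod_pos fun j _ => (hpos _).1, Finset.prod_pos fun j _ => (hpos _).2.1,
    Finset.prod_pos fun j _ => (hpos _).2.2, ?_, ?_⟩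
  · exact tensorRestrictsTo_kroneckerPow_matMulDirectSum_multiple K k m n rep hinj
      (fun β => prod_eq_of_card_filter_eq (hmem _ (hrep_mem β)) k)
      (fun β => prod_eq_of_card_filter_eq (hmem _ (hrep_mem β)) m)
      (fun β => prod_eq_of_card_filter_eq (hmem _ (hrep_mem β)) n)
  · refine hbound.trans (le_of_eq ?_)
    congr 1
    rw [hG]
    dsimp only
    rw [← hS, Finset.sum_congr rfl hconst, Finset.sum_const, nsmul_eq_mul]

end ClassChoice

/-! ## The symmetrised bound for one `N` -/

section Core

variable (K : Type) [Field K] {ι : Type} [Fintype ι] [DecidableEq ι]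

/-- **The core estimate** (Alman 2021, proof of Thm. 2.9): if the variable-symmetric `t` has
`t^{⊗n} ⊵ ⊕ᵢ ⟨aᵢ,bᵢ,cᵢ⟩` (`n ≥ 1`), then for `w ∈ [2,3]` and every `N`,
`(Σᵢ (aᵢbᵢcᵢ)^{w/3})^N ≤ 2 (N+1)^p S̃(t)^{wNn/2}`. Mechanism: extract a type class
`F ⊙ ⟨A,B,C⟩ ≤ (⊕ …)^{⊗N}`, symmetrise to `t^{⊗3Nn} ⊵ F³ ⊙ ⟨ABC,ABC,ABC⟩`, bound
`F³(ABC)² ≤ 2 S(t^{⊗3Nn}) ≤ 2 S̃(t)^{3Nn}` (Strassen's diagonal, Tao, Prop. 2.3) and use `F ≥ 1`,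
`w ≥ 2`. [cite: Alman2021, Thm. 2.9 (proof)] -/
theorem sum_rpow_pow_le_asymptoticSliceRank (t : ι → ι → ι → K) (ht : IsVariableSymmetric t)
    {n : ℕ} (hn : 0 < n) {p : ℕ} {a b c : Fin p → ℕ} (hpos : ∀ i, 0 < a i ∧ 0 < b i ∧ 0 < c i)
    (hdeg : PolyDegeneratesTo (kroneckerPow t n) (matMulDirectSum K a b c)) {w : ℝ}
    (hw : w ∈ Set.Icc (2 : ℝ) 3) (N : ℕ) :
    (∑ i, ((a i * b i * c i : ℕ) : ℝ) ^ (w / 3)) ^ N ≤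
      2 * ((N : ℝ) + 1) ^ p * (asymptoticSliceRank t ^ (w / 2)) ^ (N * n) := by
  have hSr : 0 ≤ asymptoticSliceRank t := asymptoticSliceRank_nonneg t
  rcases Nat.eq_zero_or_pos N with hN0 | hN
  · subst hN0
    simp only [pow_zero, Nat.cast_zero, zero_add, one_pow, mul_one, zero_mul]
    norm_num
  obtain ⟨F, A, B, C, hA, hB, hC, hres, hineq⟩ := exists_typeClass K a b c (w / 3) N hpos
  -- `t^{⊗Nn} ⊵ F ⊙ ⟨A,B,C⟩` and its two rotations
  have h₁ : PolyDegeneratesTo (kroneckerPow t (N * n))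
      (kroneckerTensor (unitTensor K F) (matMulTensor K A B C)) :=
    (tensorRestrictsTo_kroneckerPow_mul t N n).trans_polyDegeneratesTo
      ((hdeg.kroneckerPow N).trans_restrictsTo hres)
  have ht₁ := ht.kroneckerPow (N * n)
  have h₂ : PolyDegeneratesTo (kroneckerPow t (N * n))
      (kroneckerTensor (unitTensor K F) (matMulTensor K B C A)) :=
    (ht₁.polyDegeneratesTo_rotate h₁).trans_restrictsTo
      (tensorRestrictsTo_rotate_multiple_matMulTensor K F A B C)
  have h₃ : PolyDegeneratesTo (kroneckerPow t (N * n))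
      (kroneckerTensor (unitTensor K F) (matMulTensor K C A B)) :=
    (ht₁.polyDegeneratesTo_rotate h₂).trans_restrictsTo
      (tensorRestrictsTo_rotate_multiple_matMulTensor K F B C A)
  -- `t^{⊗3Nn} ⊵ F³ ⊙ ⟨ABC, ABC, ABC⟩`
  set Mabc := A * B * C with hM
  have hfin : PolyDegeneratesTo (kroneckerPow t (N * n + (N * n + N * n)))
      (kroneckerTensor (unitTensor K (F ^ 3)) (matMulTensor K Mabc Mabc Mabc)) := by
    have s1 : TensorRestrictsTo (kroneckerPow t (N * n + (N * n + N * n)))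
        (kroneckerTensor (kroneckerPow t (N * n))
          (kroneckerTensor (kroneckerPow t (N * n)) (kroneckerPow t (N * n)))) :=
      (tensorRestrictsTo_kroneckerPow_add t _ _).trans
        ((TensorRestrictsTo.refl _).kronecker (tensorRestrictsTo_kroneckerPow_add t _ _))
    have s2 := s1.trans_polyDegeneratesTo (h₁.kronecker (h₂.kronecker h₃))
    have s3 : TensorRestrictsTo
        (kroneckerTensor (kroneckerTensor (unitTensor K F) (matMulTensor K A B C))
          (kroneckerTensor (kroneckerTensor (unitTensor K F) (matMulTensor K B C A))
            (kroneckerTensor (unitTensor K F) (matMulTensor K C A B))))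
        (kroneckerTensor (unitTensor K (F * (F * F)))
          (matMulTensor K (A * (B * C)) (B * (C * A)) (C * (A * B)))) :=
      ((TensorRestrictsTo.refl _).kronecker
        (tensorRestrictsTo_kronecker_multiple_matMulTensor K F B C A F C A B)).trans
        (tensorRestrictsTo_kronecker_multiple_matMulTensor K F A B C (F * F) (B * C) (C * A) (A * B))
    have s4 : TensorRestrictsTo
        (kroneckerTensor (unitTensor K (F * (F * F)))
          (matMulTensor K (A * (B * C)) (B * (C * A)) (C * (A * B))))
        (kroneckerTensor (unitTensor K (F ^ 3)) (matMulTensor K Mabc Mabc Mabc)) :=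
      tensorRestrictsTo_multiple_matMulTensor_of_eq K (by ring) (by rw [hM]; ring)
        (by rw [hM]; ring) (by rw [hM]; ring)
    exact (s2.trans_restrictsTo s3).trans_restrictsTo s4
  -- slice ranks: `F³ M² ≤ 2 S(t^{⊗3Nn}) ≤ 2 S̃^{3Nn}`
  have hslice : ((F : ℝ) ^ 3) * ((Mabc : ℝ) ^ 2) ≤ 3 * asymptoticSliceRank t ^ (N * n + (N * n + N * n)) := by
    have h1 := mul_sq_le_three_mul_sliceRank_multiple_matMul (K := K) (F ^ 3) Mabc
    have h2 := hfin.sliceRank_le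
    obtain ⟨e, he⟩ : ∃ e, N * n + (N * n + N * n) = e + 1 :=
      ⟨N * n + (N * n + N * n) - 1, by have := Nat.mul_pos hN hn; omega⟩
    have h3 : (sliceRank (kroneckerPow t (N * n + (N * n + N * n))) : ℝ) ≤
        asymptoticSliceRank t ^ (N * n + (N * n + N * n)) := by
      rw [he]; exact sliceRank_pow_le_asymptoticSliceRank_pow t e
    have h4 : ((F ^ 3 * (Mabc * Mabc) : ℕ) : ℝ) ≤ ((3 * sliceRank (kroneckerPow t (N * n + (N * n + N * n))) : ℕ) : ℝ) := by
      exact_mod_cast h1.trans (Nat.mul_le_mul_left 3 h2)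
    push_cast at h4
    nlinarith [h4, h3]
  -- the real bookkeeping
  have hw2 : 2 ≤ w := hw.1
  have hw3 : w ≤ 3 := hw.2
  set Sv := ∑ i, ((a i * b i * c i : ℕ) : ℝ) ^ (w / 3) with hSv
  rcases Nat.eq_zero_or_pos F with hF0 | hF
  · -- empty class
    rw [hF0, Nat.cast_zero, zero_mul, mul_zero] at hineq
    exact hineq.trans (by positivity)
  have hF1 : (1 : ℝ) ≤ F := by exact_mod_cast hF
  have hM0 : (0 : ℝ) ≤ Mabc := Nat.cast_nonneg _
  -- `F · M^{w/3} ≤ F^{w/2} (M²)^{w/6} ≤ (3 S̃^{3Nn})^{w/6} = 3^{w/6} S̃^{wNn/2}`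
  have step1 : (F : ℝ) * (Mabc : ℝ) ^ (w / 3) ≤ ((F : ℝ) ^ 3 * (Mabc : ℝ) ^ 2) ^ (w / 6) := by
    rw [Real.mul_rpow (by positivity) (by positivity), ← Real.rpow_natCast (F : ℝ) 3,
      ← Real.rpow_mul (by positivity), ← Real.rpow_natCast (Mabc : ℝ) 2, ← Real.rpow_mul hM0]
    have e1 : ((2 : ℕ) : ℝ) * (w / 6) = w / 3 := by push_cast; ring
    rw [e1]
    refine mul_le_mul_of_nonneg_right ?_ (by positivity)
    calc (F : ℝ) = (F : ℝ) ^ (1 : ℝ) := (Real.rpow_one _).symm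
      _ ≤ (F : ℝ) ^ (((3 : ℕ) : ℝ) * (w / 6)) :=
        Real.rpow_le_rpow_of_exponent_le hF1 (by push_cast; linarith)
  have step2 : ((F : ℝ) ^ 3 * (Mabc : ℝ) ^ 2) ^ (w / 6) ≤
      (3 * asymptoticSliceRank t ^ (N * n + (N * n + N * n))) ^ (w / 6) :=
    Real.rpow_le_rpow (by positivity) hslice (by linarith)
  have step3 : (3 * asymptoticSliceRank t ^ (N * n + (N * n + N * n))) ^ (w / 6) =
      (3 : ℝ) ^ (w / 6) * (asymptoticSliceRank t ^ (w / 2)) ^ (N * n) := by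
    rw [Real.mul_rpow (by norm_num) (by positivity), ← Real.rpow_natCast (asymptoticSliceRank t),
      ← Real.rpow_mul hSr, ← Real.rpow_mul_natCast hSr]
    congr 2
    push_cast
    ring
  have step4 : (3 : ℝ) ^ (w / 6) ≤ 2 := by
    calc (3 : ℝ) ^ (w / 6) ≤ (4 : ℝ) ^ (w / 6) :=
          Real.rpow_le_rpow (by norm_num) (by norm_num) (by linarith)
      _ ≤ (4 : ℝ) ^ ((1 : ℝ) / 2) :=
          Real.rpow_le_rpow_of_exponent_le (by norm_num) (by linarith)
      _ = 2 := by
          rw [show (4 : ℝ) = 2 ^ ((2 : ℕ) : ℝ) by norm_num, ← Real.rpow_mul (by norm_num)]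
          norm_num
  have hρ0 : 0 ≤ (asymptoticSliceRank t ^ (w / 2)) ^ (N * n) := by positivity
  calc Sv ^ N ≤ ((N : ℝ) + 1) ^ p * ((F : ℝ) * ((A * B * C : ℕ) : ℝ) ^ (w / 3)) := hineq
    _ ≤ ((N : ℝ) + 1) ^ p * ((3 : ℝ) ^ (w / 6) * (asymptoticSliceRank t ^ (w / 2)) ^ (N * n)) := by
        refine mul_le_mul_of_nonneg_left ?_ (by positivity)
        exact (step1.trans step2).trans step3.le
    _ ≤ ((N : ℝ) + 1) ^ p * (2 * (asymptoticSliceRank t ^ (w / 2)) ^ (N * n)) := by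
        refine mul_le_mul_of_nonneg_left ?_ (by positivity)
        exact mul_le_mul_of_nonneg_right step4 hρ0
    _ = 2 * ((N : ℝ) + 1) ^ p * (asymptoticSliceRank t ^ (w / 2)) ^ (N * n) := by ring

end Core

/-! ## Theorem 2.9 -/

section Thm29

/-- `0` belongs to the set defining `V_τ(T)` (the empty direct sum, `n = 1`). [cite: Alman2021, §2.5] -/
theorem zero_mem_degenerationValue_set (K : Type) [Field K] {ι κ μ : Type} [Fintype ι] [Fintype κ]
    [Fintype μ] (τ : ℝ) (t : ι → κ → μ → K) :
    (0 : ℝ) ∈ {v : ℝ | ∃ n : ℕ, 0 < n ∧ ∃ (m : ℕ) (a b c : Fin m → ℕ),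
      (∀ i, 0 < a i ∧ 0 < b i ∧ 0 < c i) ∧
        PolyDegeneratesTo (kroneckerPow t n) (matMulDirectSum K a b c) ∧
          v = (∑ i, ((a i * b i * c i : ℕ) : ℝ) ^ τ) ^ (1 / (n : ℝ))} := by
  refine ⟨1, Nat.one_pos, 0, Fin.elim0, Fin.elim0, Fin.elim0, fun i => Fin.elim0 i, ?_, ?_⟩
  · exact ⟨0, fun _ x => Fin.elim0 x.1, fun _ x => Fin.elim0 x.1, fun _ x => Fin.elim0 x.1,
      fun x => Fin.elim0 x.1⟩
  · simp

/-- **Alman 2021, Theorem 2.9, in the form "every qualifying `w` is at least `2 log R̃ / log S̃`"**: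
for variable-symmetric `t` with `S̃(t) > 1`, if `w ∈ [2,3]` and `R̃(t) ≤ V_{w/3}(t)` then
`2 log R̃(t) / log S̃(t) ≤ w`. [cite: Alman2021, Thm. 2.9] -/
theorem two_mul_log_div_log_le_of_qualifying (K : Type) [Field K] {ι : Type} [Fintype ι]
    (t : ι → ι → ι → K) (ht : IsVariableSymmetric t) (hS : 1 < asymptoticSliceRank t) {w : ℝ}
    (hw : w ∈ Set.Icc (2 : ℝ) 3) (hq : asymptoticRank t ≤ degenerationValue K (w / 3) t) :
    2 * Real.log (asymptoticRank t) / Real.log (asymptoticSliceRank t) ≤ w := by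
  classical
  have hlogS : 0 < Real.log (asymptoticSliceRank t) := Real.log_pos hS
  have hSpos : 0 < asymptoticSliceRank t := zero_lt_one.trans hS
  by_contra hlt
  rw [not_le, lt_div_iff₀ hlogS] at hlt
  -- `R̃ > 1`
  have hR1 : 1 < asymptoticRank t := by
    by_contra hle
    rw [not_lt] at hle
    have : Real.log (asymptoticRank t) ≤ 0 := Real.log_nonpos (asymptoticRank_nonneg t) hle
    nlinarith [hw.1]
  have hRpos : 0 < asymptoticRank t := zero_lt_one.trans hR1
  -- `ρ = S̃^{w/2} < R̃`
  set ρ := asymptoticSliceRank t ^ (w / 2) with hρ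
  have hρpos : 0 < ρ := Real.rpow_pos_of_pos hSpos _
  have hρR : ρ < asymptoticRank t := by
    rw [← Real.log_lt_log_iff hρpos hRpos, hρ, Real.log_rpow hSpos]
    linarith
  -- pick `v` in the set defining `V_{w/3}` with `ρ < v`
  set 𝒮 := {v : ℝ | ∃ n : ℕ, 0 < n ∧ ∃ (m : ℕ) (a b c : Fin m → ℕ),
      (∀ i, 0 < a i ∧ 0 < b i ∧ 0 < c i) ∧
        PolyDegeneratesTo (kroneckerPow t n) (matMulDirectSum K a b c) ∧
          v = (∑ i, ((a i * b i * c i : ℕ) : ℝ) ^ (w / 3)) ^ (1 / (n : ℝ))} with h𝒮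
  have hq' : asymptoticRank t ≤ sSup 𝒮 := hq
  have hv : ∃ v ∈ 𝒮, ρ < v := by
    by_cases hb : BddAbove 𝒮
    · exact exists_lt_of_lt_csSup ⟨0, zero_mem_degenerationValue_set K (w / 3) t⟩ (hρR.trans_le hq')
    · exact not_bddAbove_iff.1 hb ρ
  obtain ⟨v, ⟨n, hn, p, a, b, c, hpos, hdeg, rfl⟩, hρv⟩ := hv
  set Sv := ∑ i, ((a i * b i * c i : ℕ) : ℝ) ^ (w / 3) with hSv
  have hSv0 : 0 ≤ Sv := Finset.sum_nonneg fun i _ => by positivity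
  -- `ρ^n < Sv`
  have hn0 : n ≠ 0 := hn.ne'
  have hρn : ρ ^ n < Sv := by
    have := pow_lt_pow_left₀ hρv hρpos.le hn0
    rwa [one_div, Real.rpow_inv_natCast_pow hSv0 hn0] at this
  have hρn0 : 0 < ρ ^ n := pow_pos hρpos n
  -- `(Sv / ρ^n)^N ≤ 2 (N+1)^p` for all `N`
  set α := Sv / ρ ^ n with hα
  have hα1 : 1 < α := (one_lt_div hρn0).2 hρn
  have hα0 : 0 < α := zero_lt_one.trans hα1
  have hpow : ∀ N : ℕ, α ^ N ≤ 2 * ((N : ℝ) + 1) ^ p := by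
    intro N
    have h := sum_rpow_pow_le_asymptoticSliceRank K t ht hn hpos hdeg hw N
    rw [← hSv, ← hρ, pow_mul] at h
    rw [hα, div_pow, div_le_iff₀ (pow_pos hρn0 N)]
    calc Sv ^ N ≤ 2 * ((N : ℝ) + 1) ^ p * (ρ ^ n) ^ N := by
          rw [← pow_mul, mul_comm n N]; rw [← pow_mul] at h; exact h
      _ = 2 * ((N : ℝ) + 1) ^ p * (ρ ^ n) ^ N := rfl
  -- but `(N+1)^p / α^(N+1) → 0`
  have hlim : Tendsto (fun N : ℕ => (((N + 1 : ℕ) : ℝ)) ^ p / α ^ (N + 1)) atTop (𝓝 0) :=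
    (tendsto_pow_const_div_const_pow_of_one_lt p hα1).comp (tendsto_add_atTop_nat 1)
  have hsmall : (0 : ℝ) < 1 / (2 * α) := by positivity
  obtain ⟨N, hN⟩ := (hlim.eventually (gt_mem_nhds hsmall)).exists
  rw [div_lt_div_iff₀ (by positivity) (by positivity), one_mul, pow_succ] at hN
  have h2 := mul_le_mul_of_nonneg_right (hpow N) hα0.le
  push_cast at hN
  linarith

/-- **Alman 2021, Theorem 2.9** — DISCHARGE of the named fact `Alman2021_thm29`: for a
variable-symmetric tensor `T` with `S̃(T) > 1` and `ω_u(T)` defined,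
`ω_u(T) ≥ 2 log R̃(T) / log S̃(T)`. [cite: Alman2021, Thm. 2.9] -/
theorem Alman2021_thm29_holds : Alman2021_thm29 := by
  intro K _ ι _ t ht hS hex
  obtain ⟨w₀, hw₀, hq₀⟩ := hex
  refine le_csInf ⟨3, Set.mem_union_right _ rfl⟩ ?_
  rintro w (⟨hw, hq⟩ | hw3)
  · exact two_mul_log_div_log_le_of_qualifying K t ht hS hw hq
  · rw [Set.mem_singleton_iff.1 hw3]
    exact (two_mul_log_div_log_le_of_qualifying K t ht hS hw₀ hq₀).trans hw₀.2

end Thm29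



end Literature.Barriers.MatrixMultiplication

end
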